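import Literature.AlgebraicGeometry.Motives.IntegralModelRestrictScalarsGenericPoint
import HarnessLib

/-!
# Special points of a restricted ∕ localised integral model: injective reading in the ORIGINAL model, over the special sheet

Topic `Literature/AlgebraicGeometry/Motives`; namespace `Literature.AlgebraicGeometry.Motives.IntegralModel`.  Theorems only (no `def`,
no instance, no notation, no named fact, no `sorry`).  Cell `hodgecm-mathlib`, P6 «MOD programme», sub-desk P6a, GEN layer — organ
«SPECIAL-SHEET-POINTS» (LEAD F0P6-plan M-17f, 2026-09-01, on the risk note «INJ ACROSS SHEETS»; A-p03 (g29)); sequel of ★ INT-RES-POINTS ∕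
★ Ω-SHEET-READING (`IntegralModelRestrictScalarsPoints`, `IntegralModelRestrictScalarsGenericPoint`).  HC_CM is proved only modulo the
printed citations until rung 0 closes; nothing here is about HC.

THE MATHEMATICS ([GortzWedhorn2020] Prop. 4.16, §(4.8), (14.20); [Hartshorne1977] II Thm. 3.3; [SerreTate1968] §1; [MumfordFogartyKirwan1994]
Ch. 7 §2 Def. 7.2).  Let `𝓜` be an integral model over `B` (`𝓞 L ⊆ B ⊆ L`) of an `L`-scheme `Z`, `𝓨 := (restrictScalarsOfIntermediate hinj 𝓜).localise w`
its view over `𝒪_{F,(w)}`, with special fibre `𝓨_s` over `κ(w)` and special-fibre inclusion `ι_s : 𝓨_s → 𝓨.total` (`pr₁`), and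
`π : 𝓨.total → 𝓜.total` the projection.  (§1) For ANY global model `𝒳` over `𝓞 F`, a `κ̄(w)`-point `x̄` of the special fibre of
`𝒳.localise w` is determined by the bare morphism `x̄ ≫ ι_s ≫ π : Spec κ̄ → 𝒳.total` (the other coordinates of the two fibre products are the
structure maps) — so special points of `𝓨` INJECT into `κ̄`-points of the scheme `𝓜.total`.  (§2) The image point `z̄ := x̄ ≫ ι_s ≫ π` lies over
the SPECIAL SHEET of `x̄`: `z̄ ≫ (𝓜.total → Spec B)` is the underlying morphism of ★ `specialSheet x̄` (read in `Spec B` through the sheet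
model), hence (§3) two special points have the same special sheet iff their image points induce the same `B`-structure `Spec κ̄ → Spec B`;
so the special points over ONE special sheet `s̄` inject into the `κ̄`-points of the `B`-scheme `𝓜.total` over `s̄`, i.e. of `𝓜 ⊗_{B,s̄} κ̄`
— the domain on which a FINE moduli scheme `𝓜` is injective on tuples ([MumfordFogartyKirwan1994] Def. 7.2: the functor is on `B`-schemes).
(§4) All points of the image of ONE reading `y ↦ red_𝓨 (ℓ_e y)` lie over ONE special sheet (the reduction of the generic sheet of `e`;
★ `specialSheet_geomReductionMap`, ★ `embOfPoint_genericSheet`).  (§5) For an abelian scheme `𝒜` over `𝓜.total`, the special-fibre reading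
`(𝒜 ×_{𝓜} 𝓨) ×_{𝓨} 𝓨_s` IS the base change of `𝒜` along `ι_s ≫ π` as group schemes (★ `baseChange_isBaseChangeVia` twice, ★
`IsBaseChangeVia.trans` — no identity needed), so the tuple `fibre₀Of` of the P6a moduli datum at `x̄` is `𝒜`'s fibre at `z̄`, naturally in `𝒜`
(★ `IsBaseChangeVia.exists_fibreIso[_natural]`).  Together: IMAGE-INJ (LEAD M-17f (R1)) at MH's witness reduces to fine-moduli injectivity of
`𝓜` on `κ̄`-points OVER ONE `B`-structure; a GLOBAL injectivity over all of `𝓨_s(κ̄)` would be false as soon as `𝓜` is a base change from a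
smaller ring (distinct sheets, equal tuples).

MAIN STATEMENTS.  §1 **`reductionAt_point_ext`** (any `𝒳 : IntegralModel (𝓞 F) F X`); §2 **`specialSheet_left_comp_eq`**; §3
**`specialSheet_eq_iff`**; §4 **`specialSheet_geomReductionMap_thickeningLift_eq`**; §5 **`isBaseChangeVia_baseChange_reductionAt_restrictScalarsOfIntermediate`**,
`exists_fibreIso_baseChange_reductionAt_restrictScalarsOfIntermediate`, `exists_fibreIso_natural_baseChange_reductionAt_restrictScalarsOfIntermediate`.

## References
* [GortzWedhorn2020] U. Görtz, T. Wedhorn, *Algebraic Geometry I* (2nd ed.), Prop. 4.16, §(4.7)–(4.8), (14.20).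
* [Hartshorne1977] R. Hartshorne, *Algebraic Geometry*, II Thm. 3.3 (p. 87) (fibre products and their universal property).
* [SerreTate1968] J.-P. Serre, J. Tate, *Good reduction of abelian varieties*, Ann. of Math. 88 (1968), §1 (models, reduction of points).
* [MumfordFogartyKirwan1994] D. Mumford, J. Fogarty, F. Kirwan, *Geometric Invariant Theory* (3rd ed.), Ch. 7 §2 Def. 7.2 (p. 129).
-/

set_option autoImplicit false

noncomputable section

set_option backward.isDefEq.respectTransparency false

open CategoryTheory CategoryTheory.Limits AlgebraicGeometry IsDedekindDomain IsDedekindDomain.HeightOneSpectrum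
open scoped NumberField nonZeroDivisors
open Literature.NumberTheory.EllipticCurves (genericFibre specGenericPoint)
open Literature.NumberTheory.DiophantineGeometry (geomResidueField specialFibreFunctor specResidueField)
open Literature.AlgebraicGeometry.AbelianSchemes Literature.AlgebraicGeometry.AbelianSchemes.AbelianSchemeOver

namespace Literature.AlgebraicGeometry.Motives.IntegralModel

/-! ### §1 A special point of a localised global model is determined by its image in the global total space -/

section Global

variable {F : Type} [Field F] [NumberField F] {X : SchemeOver F} (𝒳 : IntegralModel (𝓞 F) F X) (w : HeightOneSpectrum (𝓞 F))

/-- **A `κ̄(w)`-point of the special fibre of `𝒳.localise w` is determined by the bare morphism `x̄ ≫ ι_s ≫ π : Spec κ̄ → 𝒳.total`** (`ι_s` the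
special-fibre inclusion, `π : 𝒳 ⊗ 𝒪_(w) → 𝒳` the projection): the remaining coordinates of the two fibre products are the structure maps
`Spec κ̄ → Spec κ(w) → Spec 𝒪_(w)` (Mathlib `pullback.hom_ext` twice). [cite: Hartshorne1977, II Thm. 3.3 (p. 87)] [cite: SerreTate1968, §1] -/
theorem reductionAt_point_ext (x₁ x₂ : AlgPoints (𝒳.localise w).reductionAt (geomResidueField w))
    (h : x₁.left ≫ pullback.fst (𝒳.localise w).total.hom (specResidueField w) ≫
          pullback.fst 𝒳.total.hom (Spec.map (CommRingCat.ofHom (algebraMap (𝓞 F) (valuationSubringAtPrime F w)))) =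
        x₂.left ≫ pullback.fst (𝒳.localise w).total.hom (specResidueField w) ≫
          pullback.fst 𝒳.total.hom (Spec.map (CommRingCat.ofHom (algebraMap (𝓞 F) (valuationSubringAtPrime F w))))) :
    x₁ = x₂ := by
  have hw : x₁.left ≫ pullback.snd (𝒳.localise w).total.hom (specResidueField w) =
      x₂.left ≫ pullback.snd (𝒳.localise w).total.hom (specResidueField w) :=
    (Over.w x₁).trans (Over.w x₂).symm
  ext1
  apply pullback.hom_ext _ hw
  apply pullback.hom_ext
  · simpa only [Category.assoc] using h
  · -- `ι_s ≫ (structure map of 𝒳 ⊗ 𝒪_(w)) = pr₂ ≫ (Spec κ(w) → Spec 𝒪_(w))`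
    have hc := pullback.condition (f := (𝒳.localise w).total.hom) (g := specResidueField w)
    change (x₁.left ≫ pullback.fst _ _) ≫ (𝒳.localise w).total.hom = (x₂.left ≫ pullback.fst _ _) ≫ (𝒳.localise w).total.hom
    rw [Category.assoc, Category.assoc, hc, reassoc_of% hw]

end Global

/-! ### §2–§4 The restricted model: image points lie over the special sheet -/

section Intermediate

variable {F L : Type} [Field F] [NumberField F] [Field L] [NumberField L] [Algebra F L]
  {B : Type} [CommRing B] [Algebra (𝓞 L) B] [Algebra B L] [IsScalarTower (𝓞 L) B L]
  [Algebra (𝓞 F) B] [IsScalarTower (𝓞 F) B L]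
  (hinj : Function.Injective (algebraMap B L)) {Z : SchemeOver L} (w : HeightOneSpectrum (𝓞 F))

/-- **The image point lies over the special sheet**: for a special point `x̄` of `𝓨 := (restrictScalarsOfIntermediate hinj 𝓜).localise w`,
`(x̄ ≫ ι_s ≫ π) ≫ (𝓜.total → Spec B)` is the underlying morphism `Spec κ̄ → Spec B` of ★ `specialSheet x̄` read through the sheet model
(`ι_s` and `π` of the sheet model, whose total space is `Spec B` on the nose). [cite: GortzWedhorn2020, §(4.8) and (14.20)] -/
theorem specialSheet_left_comp_eq (𝓜 : IntegralModel B L Z)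
    (xbar : AlgPoints ((restrictScalarsOfIntermediate (F := F) hinj 𝓜).localise w).reductionAt (geomResidueField w)) :
    (specialSheet hinj w 𝓜 xbar).left ≫ pullback.fst ((sheetModelOf (F := F) hinj).localise w).total.hom (specResidueField w) ≫
        pullback.fst (sheetModelOf (F := F) hinj).total.hom
          (Spec.map (CommRingCat.ofHom (algebraMap (𝓞 F) (valuationSubringAtPrime F w)))) =
      (xbar.left ≫ pullback.fst ((restrictScalarsOfIntermediate (F := F) hinj 𝓜).localise w).total.hom (specResidueField w) ≫
          pullback.fst (restrictScalarsOfIntermediate (F := F) hinj 𝓜).total.hom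
            (Spec.map (CommRingCat.ofHom (algebraMap (𝓞 F) (valuationSubringAtPrime F w))))) ≫
        𝓜.total.hom := by
  -- `(U_s).left ≫ ι_s = ι_s ≫ U.left` for the special fibre of `U := localiseMap (strHomOf 𝓜)` (Mathlib `pullback.lift_fst`)
  have h1 : ((specialFibreFunctor w).map (localiseMap _ _ (strHomOf (F := F) hinj 𝓜) w)).left ≫
        pullback.fst ((sheetModelOf (F := F) hinj).localise w).total.hom (specResidueField w) =
      pullback.fst ((restrictScalarsOfIntermediate (F := F) hinj 𝓜).localise w).total.hom (specResidueField w) ≫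
        (localiseMap _ _ (strHomOf (F := F) hinj 𝓜) w).left :=
    pullback.lift_fst _ _ _
  -- `(U ⊗ 𝒪_(w)).left ≫ π = π ≫ U.left`, and `U.left = 𝓜.total.hom`
  have h2 : (localiseMap _ _ (strHomOf (F := F) hinj 𝓜) w).left ≫
        pullback.fst (sheetModelOf (F := F) hinj).total.hom
          (Spec.map (CommRingCat.ofHom (algebraMap (𝓞 F) (valuationSubringAtPrime F w)))) =
      pullback.fst (restrictScalarsOfIntermediate (F := F) hinj 𝓜).total.hom
          (Spec.map (CommRingCat.ofHom (algebraMap (𝓞 F) (valuationSubringAtPrime F w)))) ≫ 𝓜.total.hom := by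
    rw [localiseMap_eq, baseChange_map_left_comp_fst]
    rfl
  rw [specialSheet_eq, AlgPoints.map_apply, Over.comp_left, Category.assoc, Category.assoc, Category.assoc, reassoc_of% h1, h2]

/-- **Same special sheet iff same `B`-structure of the image points.** [cite: GortzWedhorn2020, §(4.8) and (14.20)]
[cite: Hartshorne1977, II Thm. 3.3 (p. 87)] -/
theorem specialSheet_eq_iff (𝓜 : IntegralModel B L Z)
    (x₁ x₂ : AlgPoints ((restrictScalarsOfIntermediate (F := F) hinj 𝓜).localise w).reductionAt (geomResidueField w)) :
    specialSheet hinj w 𝓜 x₁ = specialSheet hinj w 𝓜 x₂ ↔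
      (x₁.left ≫ pullback.fst ((restrictScalarsOfIntermediate (F := F) hinj 𝓜).localise w).total.hom (specResidueField w) ≫
          pullback.fst (restrictScalarsOfIntermediate (F := F) hinj 𝓜).total.hom
            (Spec.map (CommRingCat.ofHom (algebraMap (𝓞 F) (valuationSubringAtPrime F w))))) ≫ 𝓜.total.hom =
      (x₂.left ≫ pullback.fst ((restrictScalarsOfIntermediate (F := F) hinj 𝓜).localise w).total.hom (specResidueField w) ≫
          pullback.fst (restrictScalarsOfIntermediate (F := F) hinj 𝓜).total.hom
            (Spec.map (CommRingCat.ofHom (algebraMap (𝓞 F) (valuationSubringAtPrime F w))))) ≫ 𝓜.total.hom := by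
  rw [← specialSheet_left_comp_eq, ← specialSheet_left_comp_eq]
  exact ⟨fun h => by rw [h], fun h => reductionAt_point_ext (sheetModelOf (F := F) hinj) w _ _ h⟩

/-- **All points of the image of ONE reading lie over ONE special sheet**: for `Z = X ⊗_F L` and the reading `y ↦ red_𝓨 (ℓ_e y)` through a
fixed `F`-embedding `e : L → Ω`, the special sheets of `red_𝓨 (ℓ_e y₁)` and `red_𝓨 (ℓ_e y₂)` coincide (both are the reduction of the generic
sheet of `e`: ★ `specialSheet_geomReductionMap`, ★ `embOfPoint_genericSheet` ∕ `embOfPoint_thickeningLift` ∕ `sheet_eq_of_embOfPoint_eq`).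
This is why IMAGE-INJ (injectivity of tuples on the image of one reading) reduces to fine-moduli injectivity over ONE `B`-structure.
[cite: SerreTate1968, §1] [cite: GortzWedhorn2020, §(4.8) and (14.20)] -/
theorem specialSheet_geomReductionMap_thickeningLift_eq (X : SchemeOver F) (𝓜 : IntegralModel B L ((baseChange F L).obj X))
    [IsProper ((restrictScalarsOfIntermediate (F := F) hinj 𝓜).localise w).total.hom]
    [IsProper ((sheetModelOf (F := F) hinj).localise w).total.hom]
    (e : L →ₐ[F] AlgebraicClosure (w.adicCompletion F)) (y₁ y₂ : AlgPoints X (AlgebraicClosure (w.adicCompletion F))) :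
    specialSheet hinj w 𝓜 (((restrictScalarsOfIntermediate (F := F) hinj 𝓜).localise w).geomReductionMap (thickeningLift e X y₁)) =
      specialSheet hinj w 𝓜 (((restrictScalarsOfIntermediate (F := F) hinj 𝓜).localise w).geomReductionMap (thickeningLift e X y₂)) := by
  rw [specialSheet_geomReductionMap, specialSheet_geomReductionMap]
  congr 1
  apply sheet_eq_of_embOfPoint_eq
  rw [embOfPoint_genericSheet, embOfPoint_genericSheet, embOfPoint_thickeningLift, embOfPoint_thickeningLift]

/-! ### §5 Abelian schemes over `𝓜.total`: the special-fibre reading is the base change along `ι_s ≫ π` -/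

/-- **`(𝒜 ×_{𝓜} 𝓨) ×_{𝓨} 𝓨_s` IS `𝒜 ×_{𝓜} 𝓨_s` as group schemes** (★ `IsBaseChangeVia` along `ι_s ≫ π`, structure map `pr ≫ pr`; ★
`baseChange_isBaseChangeVia` twice and ★ `IsBaseChangeVia.trans`).  In the P6a Defs, `fibre₀Of 𝓨 w (𝒜.baseChange π) x̄` is the fibre of the
left side at `x̄`. [cite: MumfordFogartyKirwan1994, Ch. 7 §2 Definition 7.2 (p. 129)] [cite: GortzWedhorn2020, Prop. 4.16 and §(4.8)] -/
theorem isBaseChangeVia_baseChange_reductionAt_restrictScalarsOfIntermediate (𝓜 : IntegralModel B L Z)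
    (𝒜 : AbelianSchemeOver 𝓜.total.left) :
    ((𝒜.baseChange
        (pullback.fst (restrictScalarsOfIntermediate (F := F) hinj 𝓜).total.hom
          (Spec.map (CommRingCat.ofHom (algebraMap (𝓞 F) (valuationSubringAtPrime F w)))))).baseChange
        (pullback.fst ((restrictScalarsOfIntermediate (F := F) hinj 𝓜).localise w).total.hom (specResidueField w))).IsBaseChangeVia 𝒜
      (pullback.fst ((restrictScalarsOfIntermediate (F := F) hinj 𝓜).localise w).total.hom (specResidueField w) ≫
        pullback.fst (restrictScalarsOfIntermediate (F := F) hinj 𝓜).total.hom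
          (Spec.map (CommRingCat.ofHom (algebraMap (𝓞 F) (valuationSubringAtPrime F w)))))
      (pullback.fst _ _ ≫ pullback.fst _ _) :=
  (AbelianSchemeOver.baseChange_isBaseChangeVia _ _).trans (AbelianSchemeOver.baseChange_isBaseChangeVia 𝒜 _)

/-- **The special fibre tuple at `x̄` is `𝒜`'s fibre at the image point `z̄ = x̄ ≫ ι_s ≫ π`** (over the projection; ★ `IsBaseChangeVia.exists_fibreIso`).
[cite: MumfordFogartyKirwan1994, Ch. 7 §2 Definition 7.2 (p. 129)] [cite: GortzWedhorn2020, Section (4.7) (pp. 107–108) and Prop. 4.16 (p. 101)] -/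
theorem exists_fibreIso_baseChange_reductionAt_restrictScalarsOfIntermediate (𝓜 : IntegralModel B L Z)
    (𝒜 : AbelianSchemeOver 𝓜.total.left)
    (xbar : AlgPoints ((restrictScalarsOfIntermediate (F := F) hinj 𝓜).localise w).reductionAt (geomResidueField w)) :
    ∃ φ : ((((𝒜.baseChange
              (pullback.fst (restrictScalarsOfIntermediate (F := F) hinj 𝓜).total.hom
                (Spec.map (CommRingCat.ofHom (algebraMap (𝓞 F) (valuationSubringAtPrime F w)))))).baseChange
              (pullback.fst ((restrictScalarsOfIntermediate (F := F) hinj 𝓜).localise w).total.hom (specResidueField w))).fibre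
            xbar.left).toAbelianVariety ≅
          (𝒜.fibre (xbar.left ≫
            pullback.fst ((restrictScalarsOfIntermediate (F := F) hinj 𝓜).localise w).total.hom (specResidueField w) ≫
              pullback.fst (restrictScalarsOfIntermediate (F := F) hinj 𝓜).total.hom
                (Spec.map (CommRingCat.ofHom (algebraMap (𝓞 F) (valuationSubringAtPrime F w)))))).toAbelianVariety),
      AbelianVariety.Hom.toSchemeHom φ.hom ≫
          pullback.fst 𝒜.X.hom (xbar.left ≫
            pullback.fst ((restrictScalarsOfIntermediate (F := F) hinj 𝓜).localise w).total.hom (specResidueField w) ≫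
              pullback.fst (restrictScalarsOfIntermediate (F := F) hinj 𝓜).total.hom
                (Spec.map (CommRingCat.ofHom (algebraMap (𝓞 F) (valuationSubringAtPrime F w))))) =
        pullback.fst _ xbar.left ≫ (pullback.fst _ _ ≫ pullback.fst _ _) :=
  (isBaseChangeVia_baseChange_reductionAt_restrictScalarsOfIntermediate hinj w 𝓜 𝒜).exists_fibreIso xbar.left

/-- **… NATURALLY in `𝒜`** (pairs `𝒜`, `ℬ`; every pair of homomorphisms `f` upstairs, `g : 𝒜 → ℬ` with `f ≫ (pr ≫ pr) = (pr ≫ pr) ≫ g`, e.g.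
`f` the double base change of `g = ι(a)` or of a polarization; ★ `IsBaseChangeVia.exists_fibreIso_natural`).
[cite: MumfordFogartyKirwan1994, Ch. 7 §2 Definition 7.2 (p. 129)] [cite: GortzWedhorn2020, Section (4.7) (pp. 107–108) and Prop. 4.16 (p. 101)] -/
theorem exists_fibreIso_natural_baseChange_reductionAt_restrictScalarsOfIntermediate (𝓜 : IntegralModel B L Z)
    (𝒜 ℬ : AbelianSchemeOver 𝓜.total.left)
    (xbar : AlgPoints ((restrictScalarsOfIntermediate (F := F) hinj 𝓜).localise w).reductionAt (geomResidueField w)) :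
    ∃ (φ : ((((𝒜.baseChange
              (pullback.fst (restrictScalarsOfIntermediate (F := F) hinj 𝓜).total.hom
                (Spec.map (CommRingCat.ofHom (algebraMap (𝓞 F) (valuationSubringAtPrime F w)))))).baseChange
              (pullback.fst ((restrictScalarsOfIntermediate (F := F) hinj 𝓜).localise w).total.hom (specResidueField w))).fibre
            xbar.left).toAbelianVariety ≅
          (𝒜.fibre (xbar.left ≫
            pullback.fst ((restrictScalarsOfIntermediate (F := F) hinj 𝓜).localise w).total.hom (specResidueField w) ≫
              pullback.fst (restrictScalarsOfIntermediate (F := F) hinj 𝓜).total.hom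
                (Spec.map (CommRingCat.ofHom (algebraMap (𝓞 F) (valuationSubringAtPrime F w)))))).toAbelianVariety))
      (ψ : ((((ℬ.baseChange
              (pullback.fst (restrictScalarsOfIntermediate (F := F) hinj 𝓜).total.hom
                (Spec.map (CommRingCat.ofHom (algebraMap (𝓞 F) (valuationSubringAtPrime F w)))))).baseChange
              (pullback.fst ((restrictScalarsOfIntermediate (F := F) hinj 𝓜).localise w).total.hom (specResidueField w))).fibre
            xbar.left).toAbelianVariety ≅
          (ℬ.fibre (xbar.left ≫
            pullback.fst ((restrictScalarsOfIntermediate (F := F) hinj 𝓜).localise w).total.hom (specResidueField w) ≫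
              pullback.fst (restrictScalarsOfIntermediate (F := F) hinj 𝓜).total.hom
                (Spec.map (CommRingCat.ofHom (algebraMap (𝓞 F) (valuationSubringAtPrime F w)))))).toAbelianVariety)),
      AbelianVariety.Hom.toSchemeHom φ.hom ≫
            pullback.fst 𝒜.X.hom (xbar.left ≫
              pullback.fst ((restrictScalarsOfIntermediate (F := F) hinj 𝓜).localise w).total.hom (specResidueField w) ≫
                pullback.fst (restrictScalarsOfIntermediate (F := F) hinj 𝓜).total.hom
                  (Spec.map (CommRingCat.ofHom (algebraMap (𝓞 F) (valuationSubringAtPrime F w))))) =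
          pullback.fst _ xbar.left ≫ (pullback.fst _ _ ≫ pullback.fst _ _) ∧
        AbelianVariety.Hom.toSchemeHom ψ.hom ≫
            pullback.fst ℬ.X.hom (xbar.left ≫
              pullback.fst ((restrictScalarsOfIntermediate (F := F) hinj 𝓜).localise w).total.hom (specResidueField w) ≫
                pullback.fst (restrictScalarsOfIntermediate (F := F) hinj 𝓜).total.hom
                  (Spec.map (CommRingCat.ofHom (algebraMap (𝓞 F) (valuationSubringAtPrime F w))))) =
          pullback.fst _ xbar.left ≫ (pullback.fst _ _ ≫ pullback.fst _ _) ∧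
        ∀ (f : ((𝒜.baseChange
                  (pullback.fst (restrictScalarsOfIntermediate (F := F) hinj 𝓜).total.hom
                    (Spec.map (CommRingCat.ofHom (algebraMap (𝓞 F) (valuationSubringAtPrime F w)))))).baseChange
                  (pullback.fst ((restrictScalarsOfIntermediate (F := F) hinj 𝓜).localise w).total.hom (specResidueField w))).X ⟶
               ((ℬ.baseChange
                  (pullback.fst (restrictScalarsOfIntermediate (F := F) hinj 𝓜).total.hom
                    (Spec.map (CommRingCat.ofHom (algebraMap (𝓞 F) (valuationSubringAtPrime F w)))))).baseChange
                  (pullback.fst ((restrictScalarsOfIntermediate (F := F) hinj 𝓜).localise w).total.hom (specResidueField w))).X)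
          [IsMonHom f] (g : 𝒜.X ⟶ ℬ.X) [IsMonHom g],
          f.left ≫ (pullback.fst _ _ ≫ pullback.fst _ _) = (pullback.fst _ _ ≫ pullback.fst _ _) ≫ g.left →
            fibreHom f xbar.left ≫ ψ.hom =
              φ.hom ≫ fibreHom g (xbar.left ≫
                pullback.fst ((restrictScalarsOfIntermediate (F := F) hinj 𝓜).localise w).total.hom (specResidueField w) ≫
                  pullback.fst (restrictScalarsOfIntermediate (F := F) hinj 𝓜).total.hom
                    (Spec.map (CommRingCat.ofHom (algebraMap (𝓞 F) (valuationSubringAtPrime F w))))) :=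
  (isBaseChangeVia_baseChange_reductionAt_restrictScalarsOfIntermediate hinj w 𝓜 𝒜).exists_fibreIso_natural
    (isBaseChangeVia_baseChange_reductionAt_restrictScalarsOfIntermediate hinj w 𝓜 ℬ) xbar.left

end Intermediate

end Literature.AlgebraicGeometry.Motives.IntegralModel
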